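import Summits.ResolutionOfSingularities.ResolutionOfSingularities.Theorems.FrobeniusLadderFInjectiveMacaulayficationLx6c3PointFloorCharts
import Summits.ResolutionOfSingularities.ResolutionOfSingularities.Theorems.FrobeniusLadderFInjectiveMacaulayficationRegularExceptionalSlices
import Summits.ResolutionOfSingularities.ResolutionOfSingularities.Theorems.FrobeniusLadderFInjectiveMacaulayficationWFixAtNonClosedDimTwo
import Literature.AlgebraicGeometry.Resolution.AffineBlowupCartier
import HarnessLib

/-!
# NEG-N, FLOOR 0: the two-sided locus lemma of `X = U₀⁽⁰⁾ = Spec k[x,y,u,t,z]/(z² + x⁶z + y³ + u³ + t³)` (non-FULL **iff** the vertex) and the chart open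
# immersion `U₁ = Spec k[X]/(g₁) ⟶ Bl_𝔪 X` (`g₁ = z² + x⁵z + x(y³+u³+t³)`, chart `x`)
# (crux `FInjectiveMacaulayfication` stmt-ResolutionOfSingularities-15315, chain w45a; res-L1-w45a-plan-1 g19 RULINGS R19.21 «NEG-N» / R19.22 (NEG-0 → stub-3) /
# R19.23 (`hfloor = NEG-0 ∘ NEG-T`); sequel of this seat's ✓ p646544 `…Lx6c3Specimen` + ✓ p647036 `…Lx6c3PointFloorCharts` + ✓ p647478 `…Lx6c3PointFloor`;
# floor table res-L1-w45a-tri-2 g16 (`k = 0: S₀ = 𝔪, Bl 𝔪 @x, g₁`); same currency as res-L1-w45a-stub-1's `…NonFullLoopFloor{One,Three}Locus`; seat res-L1-w45a-stub-3 g10)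

[OURS · L1 W4.5a] Support file (`--supports stmt-ResolutionOfSingularities-15315 --as helper`); replaces the role of NO printed item; NOT a statement of any
manuscript; def-free; UNCONDITIONAL; `CharP k 2`. AI-written (AI review is weaker than expert review).

`X 0 = x`, `X 1 = y`, `X 2 = u`, `X 3 = t`, `X 4 = z`; `f = z² + x⁶z + y³ + u³ + t³`, `A = k[X]/(f)`, `𝔪 = (x̄,ȳ,ū,t̄,z̄) = Ideal.span (Set.range fun j => mk (X j))`;
`g₁` spelled as in stub-1's `…NonFullLoopFloorOne` (= chart `0` of `Lx6c3PointFloorCharts.theta`).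
* §1 ★★ `fullCl_localization_of_not_vertex_le` / `fullCl_stalk_of_not_vertex_le` — FULL at EVERY point off the vertex: `X` is REGULAR there
  (`Lx6c3Specimen.regular_off_vertex`, Jacobian) and regular ⇒ FULL (`RegularExceptionalSlices.cmClause_and_fClause_of_isRegularLocalRing`);
  ★★★ `not_fullCl_stalk_iff_vertex_le : ∀ w, ¬ FullCl 2 𝒪_{X,w} ↔ 𝔪 ≤ w` (with `Lx6c3Specimen.lx6c3_vertex_not_fullCl`; + the `'' ↑Finset.univ` spelling,
  + localization twin): the non-FULL locus of floor 0 IS the vertex = the N-centre `S₀ = 𝔪`;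
* §2 ★ `exists_chart_isOpenImmersion` — the scheme-level link `U₁ = Spec k[X]/(g₁) ⟶ Bl_𝔪 X`, an OPEN IMMERSION (chart `x̄`:
  `StrictTransformChartN.stub_strictTransformChartN` + Literature `affineBlowup.chartι`).
[cite: Hartshorne1977, I Thm. 5.1] [cite: Fedder1983, Prop. 1.7] [cite: StacksProject, Tag 0804]
-/

-- single-problem summit: the doubled namespace component is forced
set_option linter.dupNamespace false

noncomputable section

open AlgebraicGeometry CategoryTheory Literature.AlgebraicGeometry.Resolution TopologicalSpace IsLocalRing MvPolynomial

namespace Summit.ResolutionOfSingularities.ResolutionOfSingularities.Theorems.FInjectiveMacaulayfication.NonFullLoopFloorZero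

open Summit.ResolutionOfSingularities.ResolutionOfSingularities.Theorems.FInjectiveMacaulayfication
open SliceableCentre

variable (k : Type) [Field k]

/-! ## §1 ★★ FULL off the vertex; the two-sided locus lemma of floor 0 -/

/-- ★★ **`FullCl 2 (A_P)` at EVERY prime `P ⊉ 𝔪`** (`char k = 2`): `A_P` is regular (`Lx6c3Specimen.regular_off_vertex`), hence a domain, Cohen–Macaulay and
F-injective (`RegularExceptionalSlices.cmClause_and_fClause_of_isRegularLocalRing`). [cite: Hartshorne1977, I Thm. 5.1; Fedder1983, Prop. 1.7] -/
theorem fullCl_localization_of_not_vertex_le [CharP k 2] (f : MvPolynomial (Fin 5) k) (hf : f = X 4 ^ 2 + X 0 ^ 6 * X 4 + X 1 ^ 3 + X 2 ^ 3 + X 3 ^ 3)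
    (P : Ideal (MvPolynomial (Fin 5) k ⧸ Ideal.span {f})) [P.IsPrime]
    (hP : ¬ Ideal.span (Set.range fun j : Fin 5 => Ideal.Quotient.mk (Ideal.span {f}) (X j)) ≤ P) :
    FullCl 2 (Localization.AtPrime P) := by
  haveI := Lx6c3Specimen.regular_off_vertex k f hf P hP
  haveI : (Ideal.span {f}).IsPrime := (Ideal.span_singleton_prime (Lx6c3Specimen.prime_f k f hf).ne_zero).mpr (Lx6c3Specimen.prime_f k f hf)
  haveI : CharP (MvPolynomial (Fin 5) k ⧸ Ideal.span {f}) 2 := charP_of_injective_algebraMap (algebraMap k _).injective 2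
  haveI : CharP (Localization.AtPrime P) 2 := DegreeZeroDescent.charP_localization_atPrime 2 P
  haveI : IsDomain (Localization.AtPrime P) := isDomain_of_isRegularLocalRing (Localization.AtPrime P)
  obtain ⟨hCM, hF'⟩ := RegularExceptionalSlices.cmClause_and_fClause_of_isRegularLocalRing Nat.prime_two (Localization.AtPrime P)
  exact ⟨inferInstance, fun d hd s hmax => ⟨hCM d hd s hmax, hF' d hd s hmax⟩⟩

/-- ★★ **THE «⊆» HALF OF THE FLOOR-0 LOCUS LEMMA** (stalk form): every point `w` of `X` other than the vertex is FULL (`char k = 2`). [OURS · certificate] -/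
theorem fullCl_stalk_of_not_vertex_le [CharP k 2] (f : MvPolynomial (Fin 5) k) (hf : f = X 4 ^ 2 + X 0 ^ 6 * X 4 + X 1 ^ 3 + X 2 ^ 3 + X 3 ^ 3)
    (w : Spec (.of (MvPolynomial (Fin 5) k ⧸ Ideal.span {f})))
    (hw : ¬ Ideal.span (Set.range fun j : Fin 5 => Ideal.Quotient.mk (Ideal.span {f}) (X j)) ≤ w.asIdeal) :
    FullCl 2 ((Spec (.of (MvPolynomial (Fin 5) k ⧸ Ideal.span {f}))).presheaf.stalk w) :=
  WFixAtNonClosedDimTwo.fullCl_of_ringEquiv 2 (Spec.stalkIso (.of _) w).commRingCatIsoToRingEquiv.symm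
    (fullCl_localization_of_not_vertex_le k f hf w.asIdeal hw)

/-- ★★★ **THE FLOOR-0 LOCUS LEMMA, BOTH SIDES**: for `X = Spec k[X]/(z² + x⁶z + y³ + u³ + t³)`, `char k = 2`, a point `w` is NON-FULL **iff** `𝔪 ≤ w` (iff `w` is the
vertex): «⊇» by Fedder necessity (`Lx6c3Specimen.lx6c3_vertex_not_fullCl`), «⊆» by regularity off the vertex. The N-centre `S₀` of tri-2's table is `𝔪`,
whose `x`-chart is `U₁` (§2). [OURS · certificate; cite: Fedder1983, Prop. 1.7; Hartshorne1977, I Thm. 5.1] -/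
theorem not_fullCl_stalk_iff_vertex_le [CharP k 2] (f : MvPolynomial (Fin 5) k) (hf : f = X 4 ^ 2 + X 0 ^ 6 * X 4 + X 1 ^ 3 + X 2 ^ 3 + X 3 ^ 3) :
    ∀ w : Spec (.of (MvPolynomial (Fin 5) k ⧸ Ideal.span {f})),
      ¬ FullCl 2 ((Spec (.of (MvPolynomial (Fin 5) k ⧸ Ideal.span {f}))).presheaf.stalk w) ↔ Ideal.span (Set.range fun j : Fin 5 => Ideal.Quotient.mk (Ideal.span {f}) (X j)) ≤ w.asIdeal := by
  intro w
  refine ⟨fun h => by_contra fun hw => h (fullCl_stalk_of_not_vertex_le k f hf w hw), fun hw => ?_⟩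
  have hmax : (Ideal.span (Set.range fun j : Fin 5 => Ideal.Quotient.mk (Ideal.span {f}) (X j))).IsMaximal := DoublePointFermatCubicGerm.isMaximal_origin k f (Lx6c3Specimen.constantCoeff_f k f hf)
  exact Lx6c3Specimen.lx6c3_vertex_not_fullCl k f hf w (hmax.eq_of_le w.2.ne_top hw).symm

/-- The same in res-L1-w45a-lead-1's `Finset`-image spelling of centres (`Λ = Finset.univ`). [OURS · certificate] -/
theorem not_fullCl_stalk_iff_centre_le [CharP k 2] (f : MvPolynomial (Fin 5) k) (hf : f = X 4 ^ 2 + X 0 ^ 6 * X 4 + X 1 ^ 3 + X 2 ^ 3 + X 3 ^ 3) :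
    ∀ w : Spec (.of (MvPolynomial (Fin 5) k ⧸ Ideal.span {f})),
      ¬ FullCl 2 ((Spec (.of (MvPolynomial (Fin 5) k ⧸ Ideal.span {f}))).presheaf.stalk w) ↔
        Ideal.span ((fun j : Fin 5 => Ideal.Quotient.mk (Ideal.span {f}) (X j)) '' ((Finset.univ : Finset (Fin 5)) : Set (Fin 5))) ≤ w.asIdeal := by
  intro w
  rw [Finset.coe_univ, Set.image_univ]
  exact not_fullCl_stalk_iff_vertex_le k f hf w

/-- Localization form: `¬ FullCl 2 (A_P) ↔ 𝔪 ≤ P` for every prime `P` of `A`. [OURS · certificate] -/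
theorem not_fullCl_localization_iff_vertex_le [CharP k 2] (f : MvPolynomial (Fin 5) k) (hf : f = X 4 ^ 2 + X 0 ^ 6 * X 4 + X 1 ^ 3 + X 2 ^ 3 + X 3 ^ 3)
    (P : Ideal (MvPolynomial (Fin 5) k ⧸ Ideal.span {f})) [hPp : P.IsPrime] :
    ¬ FullCl 2 (Localization.AtPrime P) ↔ Ideal.span (Set.range fun j : Fin 5 => Ideal.Quotient.mk (Ideal.span {f}) (X j)) ≤ P := by
  refine ⟨fun h => by_contra fun hP => h (fullCl_localization_of_not_vertex_le k f hf P hP), fun hP hfull => ?_⟩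
  let w : Spec (.of (MvPolynomial (Fin 5) k ⧸ Ideal.span {f})) := ⟨P, hPp⟩
  exact (not_fullCl_stalk_iff_vertex_le k f hf w).mpr hP
    (WFixAtNonClosedDimTwo.fullCl_of_ringEquiv 2 (Spec.stalkIso (.of _) w).commRingCatIsoToRingEquiv.symm hfull)

/-! ## §2 ★ The chart open immersion `U₁ ⟶ Bl_𝔪 X` -/

set_option maxHeartbeats 800000 in
-- chart-ring types are expensive to unify (as in `StrictTransformChartN`)
/-- ★★ **`U₁ = Spec k[X]/(g₁)` IS THE REES CHART `D(x̄t)` OF `Bl_𝔪 X`**: a ring isomorphism onto `(A[𝔪t])_{(x̄t)}` sending `x̄ ↦ x̄/1`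
(`StrictTransformChartN.stub_strictTransformChartN`; the chart identity is chart `0` of `Lx6c3PointFloorCharts.theta`). [folklore; cite: GortzWedhorn2020, (13.19)] -/
theorem exists_chartEquiv_x [CharP k 2] (f : MvPolynomial (Fin 5) k) (hf : f = X 4 ^ 2 + X 0 ^ 6 * X 4 + X 1 ^ 3 + X 2 ^ 3 + X 3 ^ 3)
    (g₁ : MvPolynomial (Fin 5) k) (hg₁ : g₁ = X 4 ^ 2 + X 0 ^ 5 * X 4 + X 0 * X 1 ^ 3 + X 0 * X 2 ^ 3 + X 0 * X 3 ^ 3) :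
    ∃ e : (MvPolynomial (Fin 5) k ⧸ Ideal.span {g₁}) ≃+*
        HomogeneousLocalization.Away (reesGrading (Ideal.span (Set.range (fun j : Fin 5 => Ideal.Quotient.mk (Ideal.span {f}) (X j)))))
          (reesT ((fun j : Fin 5 => Ideal.Quotient.mk (Ideal.span {f}) (X j)) 0) (Ideal.subset_span (Set.mem_range_self 0))),
      e (Ideal.Quotient.mk (Ideal.span {g₁}) (X 0)) =
        reesChartBase ((fun j : Fin 5 => Ideal.Quotient.mk (Ideal.span {f}) (X j)) 0) (Ideal.subset_span (Set.mem_range_self 0))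
          ((fun j : Fin 5 => Ideal.Quotient.mk (Ideal.span {f}) (X j)) 0) := by
  have hfprime : (Ideal.span {f}).IsPrime := (Ideal.span_singleton_prime (Lx6c3Specimen.prime_f k f hf).ne_zero).mpr (Lx6c3Specimen.prime_f k f hf)
  have hg := Lx6c3PointFloorCharts.isPrime_span_g k f hf 0
  have hθ := Lx6c3PointFloorCharts.theta k f hf 0
  have hgX := Lx6c3PointFloorCharts.g_not_mem_span_X (k := k) 0
  simp only [Matrix.cons_val_zero] at hg hθ hgX
  subst hg₁
  exact StrictTransformChartN.stub_strictTransformChartN k 5 f _ 0 2 hfprime (Lx6c3Specimen.prime_f k f hf).ne_zero hg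
    (PrimeTransfer.X_not_mem_span_of_isPrime hg hgX) hθ _ rfl

/-- ★ **THE FLOOR-0 → FLOOR-1 LINK AT SCHEME LEVEL**: `U₁ = Spec k[X]/(g₁)` is an OPEN SUBSCHEME of `Bl_𝔪 X` — the composite of the iso `Spec` of
`exists_chartEquiv_x` with the chart `affineBlowup.chartι` at `x̄`. [folklore assembly; cite: StacksProject, Tag 0804] -/
theorem exists_chart_isOpenImmersion [CharP k 2] (f : MvPolynomial (Fin 5) k) (hf : f = X 4 ^ 2 + X 0 ^ 6 * X 4 + X 1 ^ 3 + X 2 ^ 3 + X 3 ^ 3)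
    (g₁ : MvPolynomial (Fin 5) k) (hg₁ : g₁ = X 4 ^ 2 + X 0 ^ 5 * X 4 + X 0 * X 1 ^ 3 + X 0 * X 2 ^ 3 + X 0 * X 3 ^ 3) :
    ∃ j : Spec (.of (MvPolynomial (Fin 5) k ⧸ Ideal.span {g₁})) ⟶ affineBlowup (Ideal.span (Set.range fun j : Fin 5 => Ideal.Quotient.mk (Ideal.span {f}) (X j))),
      IsOpenImmersion j := by
  obtain ⟨e, -⟩ := exists_chartEquiv_x k f hf g₁ hg₁
  exact ⟨Spec.map e.symm.toCommRingCatIso.hom ≫ affineBlowup.chartι (I := Ideal.span (Set.range fun j : Fin 5 => Ideal.Quotient.mk (Ideal.span {f}) (X j)))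
      (Ideal.Quotient.mk (Ideal.span {f}) (X 0)) (Ideal.subset_span (Set.mem_range_self 0)), inferInstance⟩

end Summit.ResolutionOfSingularities.ResolutionOfSingularities.Theorems.FInjectiveMacaulayfication.NonFullLoopFloorZero

end
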